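import Summits.ABC.IUTFork.Cor312LicenceShallowRealLevels
import Summits.ABC.IUTFork.Repair.CandInternal2RealHex
import HarnessLib

/-!
# D-0079 RESCUE sub-cell R-H (rung LADDER-ABC:A2.RESCUE.H), ROUND 1 row 8 `heightclass` — H⋆ = «DATUM HEIGHT CLASS» (`HBand` / `H`):
# the lens-STRENGTHEN candidate of abc-iut-lens-strengthen-1, FILED by the pair-8 TYPER abc-iut-rh-typ-8 with its k1 evaluation lemmas

[R-H candidate, hypothesis — not a fact.] DEFINITION + proof file of the abc-iut cell (seat abc-iut-rh-typ-8 gen 0 = R-H ROUND 1 PAIR n = 8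
TYPER, director-abc 2026-08-26T15:32:46Z / HUMAN RULING D-0107; lead abc-iut-rh-lead g0; tester abc-iut-rh-tst-8; k2 desk rp-m2 / rp-d3 via row 15).
AUTHOR OF THE CANDIDATE: abc-iut-lens-strengthen-1 g0 (CARD `HOME/staging/RH/abc-iut-lens-strengthen-1/CARD-heightclass.md` 04b758c0530f1c16, Lean
sketch `HStar-heightclass.lean` 0a56c7b278705703, `CANDIDATE.md` 4edda4809bb5fb62) — §A below is the author's typed vocabulary and candidate VERBATIM
(START-HERE §4: «a candidate is re-filed by a prover hand, never the lens seat»); §T is this seat's typer block (evaluation lemmas the k1 recipe needs,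
the declared A6 slice in closed form, the k4 witness cell against I06⋆ BY NAME). TAKES NO SIDE on [IUTchIII] Cor. 3.12 or on any author
(Mochizuki / Scholze–Stix / Joshi / Dupuy–Hilado); nothing here asserts abc proved or refuted; `HBand` / `H` are claim-tagged `def … : Prop`
HYPOTHESES over abc-iut-c312-3's Dupuy–Hilado pilot data `PilotData` (intended instance: abc-iut-C-cert-3's `Cor312Prov.pilotDataOfK D K`, print's own
`K`-level datum), never Literature facts; typed ≠ proved; instantiated ≠ endorsed. 0 new `Prop` FACTS; DEFS-FREEZE respected; standard axioms.

THE ROW (verbatim, `plan/rescue/R-H/RH-CANDIDATES.tsv` v1.5, one writer abc-iut-rh-lead g0, row 8 `heightclass`, re-bound 17:00Z to the author CARD,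
superseding the harvested v1 row 8 «datum-class-H-lt-4» — typed separately in `Repair/RHDatumClassHLt4.lean`): «HBand: ∀ bad w|p odd, ∀ j <= l*:
(j^2-1)·m_q(w) <= j·(e_w − r_w) + (1 − r_w), r_w := r#(p,e_w) = strict-min_t(p^t − t·e_w) if untied else e_w; general fibres: donor rate g_p <= 1 − r_x/e_x
for all x|p». k1 recipe: «integers: m_q := e_w·H/(2l); r := col 32 r_out_sharp if not (tie) else e_w; CELL := [(j^2-1)·m_q <= j·(e_w − r) + (1 − r)];
DATUM := AND over bad w, j = 1..l* (top label binding)»; A6 SLICE DECLARED (before numbers): «HEX k <= k0(p,e_w,l) = floor(l·(l*(e_w − r) + 1 − r)/((l*^2 −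
1)·e_w)) (lamSeven e_w=11, l=11: k0 = 3)». k2 door (row 15): «HBand-cell => SlotReachWindow-cell → lens-wuc-1 multiReach_of_slotReachWindow → w5-d107
qRegion_subset_thetaHull_settingDHVolSharp_of_multiReach → exists_qPinned_and_hull_iff». k4: «HEX:1:11@p7.j5.ev1 (I06⋆ NEG; HBand POS 24 <= 80)».

UNITS (START-HERE v1.2 §1–§2; `I06STAR-COLUMNS.tsv` v3 0be3842e1fecb6e1, writer abc-iut-rh-num-1): bad place `w | p`, `e_w = ramIdx` (`e(w|p)`),
`m_q(w) = X.qPilot w = ord_w(q)/(2l) ∈ ℤ_{≥1}` at genuine data ([IUTchI] Ex. 3.2 (iv); `Cor312LicenceShallowGenuineK.one_le_qPilot_pilotDataOfK`), labels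
`j = i+1 ≤ l⋆`; `r♯(p,e) = strict-min_t (p^t − t·e)` = the EXACT valuation of `log_p(1 + ϖ_w)` when untied (abc-iut-rp-x2 SHARP-UPPER-EDGE p454995, column
`r_out_sharp`), a certified MEMBER valuation of `log_p 𝒪^×_w`. The HBand CELL «`(j²−1)·m_q ≤ j·(e_w − r) + (1 − r)`» is the wild analogue of the TAME band top
`θ_j = j` (`(j²−1)·m_q ≤ j·(e_w − 1)`, abc-iut-w5-d068 RH-TAME-JOIN; law (L1)) with the shell's `1` replaced by the certified member valuation `r`.

§T RESULTS (typer). `strictMinPow_7_11` (`r♯(7,11) = −4`), `strictMinPow_7_330` (`r♯(7,330) = −647`: R-W's CERTIFIED `k = 1` HEX type `ev30`),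
`not_strictMinPow_7_42` (the TIE `7 − 42 = 49 − 84 = −35`: no untied exponent, fallback `r = e_w`); `band_le_of_top` — THE TOP LABEL BINDS: for `r ≤ 1 ≤ e`,
`0 ≤ m`, the cell at `J` implies the cell at every `1 ≤ j ≤ J` (concavity in `j`; so DATUM = the `j = l⋆` cell, as the recipe says); `hexSlice_iff` — on a
HEX-type group (`m_q = k·ε`, `e_w = l·ε`... stated abstractly: `(l⋆²−1)·m ≤ l⋆(e−r) + (1−r)` is the top cell) the declared A6 slice threshold in closed form with
the worked instance `k₀(7, 11, 11) = 3` (`hexSlice_7_11_11`: `k = 3` POS `72 ≤ 80`, `k = 4` NEG `96 > 80`) and at the certified type `k₀(7, 330, 11) = 7`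
(`hexSlice_7_330_11`: `5533`); the k4 WITNESS CELL `HEX:1:11@p7.j5.ev1`: HBand POS (`hBand_cell_7_11_1_5`) while the I06⋆ top cell is DECIDED-NEG there for every
`K/ℚ_7` with `e ≤ 11` and `‖q̲‖ = 7^{−1/11}` (`i06star_neg_7_11_l11`, abc-iut-rp-d2's `CandInternal2RealHex.not_mem_topLabel_seven` BY NAME, `M = 2`, `E = 11`)
— so H⋆ is NOT I06⋆ renamed. k1 (two engines agree: abc-iut-rh-num-1 RH-K1-BATCH-v3 06fc4794086ea1e7 and this seat's `k1_hband.py`, r♯ column 2644/2644):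
pooled 56.7–57.2 % (lamSeven 84/256, frey:szpiro-bad 297/876, frey:szpiro-bad∧window 897/1076, hex-v2 45/146, quad 11/12) < 95 % ⟹ KILL(k1) pooled by the
verbatim rule; POS ∩ R-W-refuted = 0 on every family (law (L2) consistency); on the DECLARED A6 slice «HEX: k ≤ k₀(p,e_w,l)» 291/291 POS and 0 refuted
(lamSeven 84, strip 162, hex-v2 45) ⟹ KEEP-on-slice / WINDOW-LOCATOR candidate, k2 via row 15. Evidence: `HOME/staging/RH/abc-iut-rh-typ-8/K1-row8-heightclass.md`.
[claim: Mochizuki2012, status: disputed] for every quoted IUT reading; [cite: Mochizuki2012, IUTchIV Prop. 1.2 (i) p. 10, Prop. 1.4 (iii) p. 13];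
[cite: MochizukiAbsTopIII2015, Def 5.4 (iii) p. 126]; [cite: DupuyHilado2025, §3.3].
-/

noncomputable section

open Set Metric Function NumberField IsDedekindDomain
open scoped Pointwise

namespace Summit.ABC.IUTFork.Repair.RHHeightClass

open Thm311 Thm311.Real Cor312 Cor312Vol Literature.IUT.LogThetaLattice Literature.IUT.LogVolume
open Literature.NumberTheory.NumberFields Literature.AnabelianGeometry.AbsoluteAnabelian
  Summit.ABC.IUTFork.Repair.CandInternal2RealHex

/-! ## §A. The candidate (author abc-iut-lens-strengthen-1, verbatim from `HStar-heightclass.lean` 0a56c7b278705703) -/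

/-- **UNTIED SHARP OUTER EXPONENT.** `r` is the STRICT minimum of `t ↦ p^t − t·e` over `t : ℕ` (column `r_out_sharp` of
I06STAR-COLUMNS v2.1 on rows not flagged `(tie)`): then `log_p(1 + ϖ_w)` is a unit-log of `w`-valuation exactly `r`
(ultrametric equality case), a CERTIFIED member valuation.  Pure arithmetic of `(p, e)`. CANDIDATE vocabulary, NOT asserted.
[claim: Mochizuki2012, status: disputed] -/
@[claim "Mochizuki2012" "disputed"]
def StrictMinPow (p e : ℕ) (r : ℤ) : Prop :=
  ∃ t : ℕ, (p : ℤ) ^ t - t * e = r ∧ ∀ t' : ℕ, t' ≠ t → r < (p : ℤ) ^ t' - t' * e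

/-- **CERTIFIED MEMBER VALUATION at a place of type `(p, e)`**: either the untied sharp exponent, or the fallback `r = e`
(`p ∈ log_p 𝒪^×` for `p` odd, valuation `e`).  Datum-level: reads `(p, e)` only. CANDIDATE vocabulary, NOT asserted.
[claim: Mochizuki2012, status: disputed] -/
@[claim "Mochizuki2012" "disputed"]
def CertVal (p e : ℕ) (r : ℤ) : Prop := StrictMinPow p e r ∨ r = e

/-- **CLASS CELL** (floor-free slot-reach cell with inner conductor `A := 1`, last-slot member valuation `r`, donor rate `g`):
`(j²·m_q − 1)/e ≤ (m_q − r)/e + j·g`.  Pure arithmetic. CANDIDATE vocabulary, NOT asserted. [claim: Mochizuki2012, status: disputed] -/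
@[claim "Mochizuki2012" "disputed"]
def ClassCell (e : ℕ) (mq r g : ℝ) (j : ℕ) : Prop :=
  ((j : ℝ) ^ 2 * mq - 1) / e ≤ (mq - r) / e + j * g

variable {F : Type} [Field F] [NumberField F] (X : PilotData F)

/-- **H⋆ = DATUM HEIGHT CLASS** (general fibres).  For every odd prime `p` under a bad place: a DONOR RATE `g_p` certified at every
place `x | p` of the Θ-index fibre by a datum-level member valuation (`g_p ≤ 1 − r_x/e_x`, `CertVal p e_x r_x`), and at every bad
`x | p` and label `j = i+1` the class cell with the datum-level last-slot valuation `r_x`.  Reads ONLY `p, e_x = ramIdx F x,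
m_q(x) = X.qPilot x, j`; no lattice invariant.  CANDIDATE, NOT asserted. [claim: Mochizuki2012, status: disputed] -/
@[claim "Mochizuki2012" "disputed"]
def H : Prop :=
  ∀ pp : Nat.Primes,
    haveI : Fact (pp : ℕ).Prime := ⟨pp.2⟩
    (∃ x : (thetaIndex X).Fibre (.inr pp), placeOf X pp.1 x ∈ X.S) →
      2 < (pp : ℕ) ∧
      ∃ g : ℝ,
        (∀ x : (thetaIndex X).Fibre (.inr pp), ∃ r : ℤ,
            CertVal pp (ramIdx F (placeOf X pp.1 x)) r ∧ g ≤ 1 - (r : ℝ) / (ramIdx F (placeOf X pp.1 x) : ℝ)) ∧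
        ∀ (i : Fin X.lstar) (x : (thetaIndex X).Fibre (.inr pp)), placeOf X pp.1 x ∈ X.S →
          ∃ r : ℤ, CertVal pp (ramIdx F (placeOf X pp.1 x)) r ∧
            ClassCell (ramIdx F (placeOf X pp.1 x)) (X.qPilot (placeOf X pp.1 x)) r g ((i : ℕ) + 1)

/-- **H⋆ BAND FORM** (uniform fibres: one ramification index `e_p` over `p`, as on every HEX / MHEX row): in I06⋆ currency
`(j² − 1)·m_q(w) ≤ j·(e_w − r) + (1 − r)` with `CertVal p e_w r` — the wild analogue of the tame band's top `θ_j = j`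
(tame: `r = 1`, `(j²−1)·m_q ≤ j·(e_w − 1)`).  CANDIDATE, NOT asserted. [claim: Mochizuki2012, status: disputed] -/
@[claim "Mochizuki2012" "disputed"]
def HBand : Prop :=
  ∀ (pp : Nat.Primes) (i : Fin X.lstar) (x : (thetaIndex X).Fibre (.inr pp)),
    haveI : Fact (pp : ℕ).Prime := ⟨pp.2⟩
    placeOf X pp.1 x ∈ X.S →
      2 < (pp : ℕ) ∧
      (∀ x' : (thetaIndex X).Fibre (.inr pp), ramIdx F (placeOf X pp.1 x') = ramIdx F (placeOf X pp.1 x)) ∧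
      ∃ r : ℤ, CertVal pp (ramIdx F (placeOf X pp.1 x)) r ∧
        ((((i : ℕ) : ℝ) + 1) ^ 2 - 1) * X.qPilot (placeOf X pp.1 x)
          ≤ (((i : ℕ) : ℝ) + 1) * ((ramIdx F (placeOf X pp.1 x) : ℝ) - r) + (1 - r)

/-- Numeric sanity (k4 witness cell `HEX:1:11@p7.j5.ev1`: `p = 7, e_w = 11, r♯ = 7 − 11 = −4, m_q = 1, j = 5`):
band `24·1 ≤ 5·15 + 5`. -/
example : (((5 : ℝ)) ^ 2 - 1) * 1 ≤ (5 : ℝ) * ((11 : ℝ) - (-4)) + (1 - (-4)) := by norm_num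

/-- Numeric sanity, NEGATIVE side of the class at the same place type with `m_q = 4` (HEX k = 4): `24·4 = 96 > 80`. -/
example : ¬ ((((5 : ℝ)) ^ 2 - 1) * 4 ≤ (5 : ℝ) * ((11 : ℝ) - (-4)) + (1 - (-4))) := by norm_num


/-! ## §T. Typer block (abc-iut-rh-typ-8): evaluation lemmas for k1, the declared A6 slice, the k4 witness cell -/

section Arith

/-- **`r♯(7, 11) = −4`, UNTIED** (`t = 1`: `7 − 11 = −4`; `t = 0`: `1`; `t = 2`: `27`; larger `t` larger): the HEX `k = 1`, `l = 11` type `ev1`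
(`e_w = 11`) has a certified member valuation `−4` — column `r_out_sharp = -4`. [folklore] -/
theorem strictMinPow_7_11 : StrictMinPow 7 11 (-4) := by
  refine ⟨1, by norm_num, fun t' ht' => ?_⟩
  rcases Nat.lt_or_ge t' 3 with h | h
  · interval_cases t' <;> simp_all
  · obtain ⟨s, rfl⟩ := Nat.exists_eq_add_of_le h
    have h1 : (s : ℤ) + 1 ≤ (7 : ℤ) ^ s := by
      have := Nat.lt_pow_self (show 1 < 7 by norm_num) (n := s)
      exact_mod_cast this
    push_cast
    rw [pow_add]
    nlinarith [h1]

/-- **`r♯(7, 330) = −647`, UNTIED** (`t = 3`: `343 − 990`; `t = 0, 1, 2, 4`: `1, −323, −611, 1081`): R-W's CERTIFIED `k = 1` HEX local type `ev30`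
(`e_w = 330`, kit N1) — column `r_out_sharp = -647`. [folklore] -/
theorem strictMinPow_7_330 : StrictMinPow 7 330 (-647) := by
  refine ⟨3, by norm_num, fun t' ht' => ?_⟩
  rcases Nat.lt_or_ge t' 5 with h | h
  · interval_cases t' <;> simp_all
  · obtain ⟨s, rfl⟩ := Nat.exists_eq_add_of_le h
    have h1 : (s : ℤ) + 1 ≤ (7 : ℤ) ^ s := by
      have := Nat.lt_pow_self (show 1 < 7 by norm_num) (n := s)
      exact_mod_cast this
    push_cast
    rw [pow_add]
    nlinarith [h1]

/-- **The TIE at `(7, 42)`**: `7 − 42 = 49 − 84 = −35`, so `−35` is NOT an untied minimum — the recipe's fallback `r := e_w` applies on such rows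
(`HEX:k:7@….ev6`, column `-35(tie)`). [folklore] -/
theorem not_strictMinPow_7_42 : ¬ StrictMinPow 7 42 (-35) := by
  rintro ⟨t, ht, hmin⟩
  rcases Nat.lt_or_ge t 3 with h | h
  · interval_cases t
    · norm_num at ht
    · exact absurd (hmin 2 (by norm_num)) (by norm_num)
    · exact absurd (hmin 1 (by norm_num)) (by norm_num)
  · obtain ⟨s, rfl⟩ := Nat.exists_eq_add_of_le h
    have h1 : (s : ℤ) + 1 ≤ (7 : ℤ) ^ s := by
      have := Nat.lt_pow_self (show 1 < 7 by norm_num) (n := s)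
      exact_mod_cast this
    push_cast at ht
    rw [pow_add] at ht
    nlinarith [h1, ht]

/-- **THE TOP LABEL BINDS.** For `r ≤ 1 ≤ e` (every untied `r♯ ≤ 1`, value at `t = 0`) and any `m`, the band cell at a label `J` implies it at every label
`1 ≤ j ≤ J`: `j ↦ j(e − r) + (1 − r) − (j² − 1)m` is concave with nonnegative value at `j = 1`; algebraically
`(j²−1)[J(e−r) + (1−r)] − (J²−1)[j(e−r) + (1−r)] = (j − J)[(e−r)(jJ+1) + (1−r)(j+J)] ≤ 0`. So the DATUM verdict is the `j = l⋆` cell, as the recipe says.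
[folklore] -/
theorem band_le_of_top {e r m : ℝ} (hr : r ≤ 1) (he : 1 ≤ e) {j J : ℕ} (h1 : 1 ≤ j) (hjJ : j ≤ J)
    (hJ : (((J : ℝ)) ^ 2 - 1) * m ≤ (J : ℝ) * (e - r) + (1 - r)) :
    (((j : ℝ)) ^ 2 - 1) * m ≤ (j : ℝ) * (e - r) + (1 - r) := by
  have hj1 : (1 : ℝ) ≤ j := by exact_mod_cast h1
  have hjJ' : (j : ℝ) ≤ J := by exact_mod_cast hjJ
  have hJ1 : (1 : ℝ) ≤ J := hj1.trans hjJ'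
  -- `(j²−1)·m·(J²−1) ≤ (j²−1)·[J(e−r)+(1−r)]` and the key factorisation
  have hA : 0 ≤ (e - r) * ((j : ℝ) * J + 1) + (1 - r) * ((j : ℝ) + J) := by
    have : 0 ≤ e - r := by linarith
    have : 0 ≤ 1 - r := by linarith
    positivity
  have hkey : (((j : ℝ)) ^ 2 - 1) * ((J : ℝ) * (e - r) + (1 - r)) ≤ (((J : ℝ)) ^ 2 - 1) * ((j : ℝ) * (e - r) + (1 - r)) := by
    have hfac : (((J : ℝ)) ^ 2 - 1) * ((j : ℝ) * (e - r) + (1 - r)) - (((j : ℝ)) ^ 2 - 1) * ((J : ℝ) * (e - r) + (1 - r)) =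
        ((J : ℝ) - j) * ((e - r) * ((j : ℝ) * J + 1) + (1 - r) * ((j : ℝ) + J)) := by ring
    nlinarith [mul_nonneg (sub_nonneg.2 hjJ') hA]
  rcases eq_or_lt_of_le hJ1 with hJeq | hJlt
  · -- `J = 1`, hence `j = 1`
    have hj : (j : ℝ) = 1 := le_antisymm (hJeq ▸ hjJ') hj1
    rw [hj]; nlinarith
  · have hJpos : 0 < ((J : ℝ)) ^ 2 - 1 := by nlinarith
    have hjnn : 0 ≤ ((j : ℝ)) ^ 2 - 1 := by nlinarith
    -- multiply `hJ` by `(j²−1) ≥ 0`, compare with `hkey`, divide by `(J²−1) > 0`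
    have h2 : (((j : ℝ)) ^ 2 - 1) * ((((J : ℝ)) ^ 2 - 1) * m) ≤ (((j : ℝ)) ^ 2 - 1) * ((J : ℝ) * (e - r) + (1 - r)) :=
      mul_le_mul_of_nonneg_left hJ hjnn
    have h3 : (((J : ℝ)) ^ 2 - 1) * ((((j : ℝ)) ^ 2 - 1) * m) ≤ (((J : ℝ)) ^ 2 - 1) * ((j : ℝ) * (e - r) + (1 - r)) := by nlinarith
    exact le_of_mul_le_mul_left h3 hJpos

/-- **The declared A6 slice in closed form.** On a group with `m_q = k·ε` and top label `l⋆` (HEX families: `e_w = l·ε`, `H = 2k`, so `m_q = e_w·H/(2l) = k·ε`),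
the top HBand cell «`(l⋆²−1)·k·ε ≤ l⋆(e−r) + (1−r)`» holds iff `k·((l⋆²−1)·ε) ≤ l⋆(e − r) + (1 − r)`, i.e. `k ≤ k₀ := ⌊(l⋆(e−r)+1−r)/((l⋆²−1)ε)⌋` for
integers (`ε ≥ 1`, `l⋆ ≥ 2`). Pure bookkeeping of the recipe's slice word. [folklore] -/
theorem hexSlice_iff {k ε e r : ℤ} {ls : ℕ} :
    (((ls : ℤ)) ^ 2 - 1) * (k * ε) ≤ (ls : ℤ) * (e - r) + (1 - r) ↔ k * ((((ls : ℤ)) ^ 2 - 1) * ε) ≤ (ls : ℤ) * (e - r) + (1 - r) := by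
  constructor <;> intro h <;> nlinarith [h]

/-- **Worked slice `k₀(7, 11, l = 11) = 3`** (author's closed form: `⌊11·(5·15 + 5)/(24·11)⌋ = ⌊80/24⌋ = 3`; `ε = 1`, `r = −4`): the top cells at
`k = 1, 2, 3` hold (`24, 48, 72 ≤ 80`) and at `k = 4` FAIL (`96 > 80`) — the HEX rows `lamSeven:k≤3:l=11@….ev1` are IN the slice, `k ≥ 4` OUT. [folklore] -/
theorem hexSlice_7_11_11 :
    (∀ k : ℕ, k ≤ 3 → (((5 : ℤ)) ^ 2 - 1) * ((k : ℤ) * 1) ≤ (5 : ℤ) * ((11 : ℤ) - (-4)) + (1 - (-4))) ∧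
      ¬ (((5 : ℤ)) ^ 2 - 1) * ((4 : ℤ) * 1) ≤ (5 : ℤ) * ((11 : ℤ) - (-4)) + (1 - (-4)) := by
  refine ⟨fun k hk => ?_, by norm_num⟩
  have hk' : (k : ℤ) ≤ 3 := by exact_mod_cast hk
  nlinarith

/-- **Slice at R-W's CERTIFIED `k = 1`..`16` type `ev30` for `l = 11`** (`e_w = 330`, `ε = 30`, `r♯ = −647`): top cell `24·30·k ≤ 5·977 + 648 = 5533` iff
`k ≤ 7` (`720·7 = 5040 ≤ 5533 < 5760`) — `k₀(7, 330, 11) = 7`: the certified-type HEX data `λ_k`, `k ≤ 7`, are IN the declared slice at `l = 11`. [folklore] -/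
theorem hexSlice_7_330_11 :
    (∀ k : ℕ, k ≤ 7 → (((5 : ℤ)) ^ 2 - 1) * ((k : ℤ) * 30) ≤ (5 : ℤ) * ((330 : ℤ) - (-647)) + (1 - (-647))) ∧
      ¬ (((5 : ℤ)) ^ 2 - 1) * ((8 : ℤ) * 30) ≤ (5 : ℤ) * ((330 : ℤ) - (-647)) + (1 - (-647)) := by
  refine ⟨fun k hk => ?_, by norm_num⟩
  have hk' : (k : ℤ) ≤ 7 := by exact_mod_cast hk
  nlinarith

/-- **k4 WITNESS CELL, HBand side**: `HEX:1:11@p7.j5.ev1` (`e_w = 11`, `r = −4`, `m_q = 1`, `j = 5`): `(25−1)·1 = 24 ≤ 5·15 + 5 = 80` — HBand POS, in the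
real currency of `HBand`. [folklore] -/
theorem hBand_cell_7_11_1_5 : (((5 : ℝ)) ^ 2 - 1) * 1 ≤ (5 : ℝ) * ((11 : ℝ) - (-4 : ℤ)) + (1 - (-4 : ℤ)) := by norm_num

end Arith

section I06Star

variable (K : Type*) [NontriviallyNormedField K] [NormedAlgebra ℚ_[7] K] [IsUltrametricDist K] [ProperSpace K]

/-- **k4 WITNESS CELL, I06⋆ side: DECIDED-NEG** — at every `K/ℚ_7` with ramification `e ≤ 11` and every `q̲` with `‖q̲‖ = 7^{−1/11}` (the HEX `k = 1`,
`l = 11` Kummer datum at a type-`ev1` place), the TOP-LABEL content of RP-I06⋆ FAILS: `q̲ ∉ q̲^{25}·ℐ_K` (abc-iut-rp-d2's integer trigger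
`CandInternal2RealHex.not_mem_topLabel_seven` BY NAME with `E = 11`, `M = 2`: `77 < 294`, `4·11·2 = 88 ≤ 1·8·12 = 96`). Together with `hBand_cell_7_11_1_5`:
H⋆ holds where I06⋆ is refuted as typed — H⋆ is NOT I06⋆ renamed (k4). [cite: MochizukiAbsTopIII2015, Def 5.4 (iii) p. 126] [claim: Mochizuki2012, status: disputed] -/
theorem i06star_neg_7_11_l11 {q : K} (hq : ‖q‖ = (7 : ℝ) ^ (-(((1 : ℕ) : ℝ) / ((11 : ℕ) : ℝ)))) (he : absRamificationIdx 7 K ≤ 11) :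
    q ∉ q ^ (((11 - 1) / 2) ^ 2) • logShell (PadicLogOnUnits.ofUnitLog 7 K) :=
  not_mem_topLabel_seven K (k := 1) (l := 11) (M := 2) (E := 11) (by norm_num) (by decide) hq he (by norm_num) (by norm_num)

end I06Star

/-! ## §T2. (APPENDED 2026-08-26 by the typer) The k1 EVALUATION LEMMA: at an UNTIED place `HBand`'s `∃ r, CertVal … ∧ cell r` IS the cell at `r♯`

The engines (abc-iut-rh-num-1 RH-K1-BATCH-v3, this seat's `k1_hband.py`, rh-kit-1 j256948, rh-kit-2 j257373) evaluate the band cell at `r := r♯(p, e_w)` when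
the strict minimum is untied and at `r := e_w` otherwise. This block proves that recipe EXACT for the typed `HBand`: the cell's right side `j(e − r) + (1 − r)`
is antitone in `r`; a certified `r` (`CertVal`) is either the unique strict minimum `r♯ ≤ 1` or the fallback `e ≥ 1 ≥ r♯`; hence at an untied place
`(∃ r, CertVal p e r ∧ cell r) ↔ cell r♯`, and on a datum all of whose bad places are untied `HBand X` is EQUIVALENT to «odd residue characteristic ∧ uniform
fibres ∧ the integer cell at `r♯` everywhere» — exactly what column 32 `r_out_sharp` + the recipe compute. Pure bookkeeping; no side taken. -/

section Eval

/-- A strict minimum of `t ↦ p^t − t·e` is `≤ 1` (the value at `t = 0`). [folklore] -/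
theorem strictMinPow_le_one {p e : ℕ} {r : ℤ} (h : StrictMinPow p e r) : r ≤ 1 := by
  obtain ⟨t, ht, hmin⟩ := h
  by_cases h0 : t = 0
  · subst h0; simp at ht; omega
  · have := hmin 0 (fun h => h0 h.symm)
    simpa using this.le

/-- The strict minimum is UNIQUE: two `StrictMinPow` certificates at the same `(p, e)` carry the same value. [folklore] -/
theorem strictMinPow_unique {p e : ℕ} {r r' : ℤ} (h : StrictMinPow p e r) (h' : StrictMinPow p e r') : r = r' := by
  obtain ⟨t, ht, hmin⟩ := h
  obtain ⟨t', ht', hmin'⟩ := h'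
  by_cases htt : t' = t
  · subst htt; rw [← ht, ← ht']
  · have h1 := hmin t' htt      -- r < p^t' − t'e = r'
    have h2 := hmin' t (fun h => htt h.symm)  -- r' < p^t − t e = r
    rw [ht'] at h1; rw [ht] at h2
    exact absurd (h1.trans h2) (lt_irrefl _)

/-- A certified member valuation is `≥ r♯` whenever `r♯` is the (untied) strict minimum: either it IS `r♯`, or it is the fallback `e ≥ 1 ≥ r♯`. [folklore] -/
theorem le_of_certVal_of_strictMin {p e : ℕ} {r₀ r : ℤ} (he : 1 ≤ e) (h₀ : StrictMinPow p e r₀) (hr : CertVal p e r) : r₀ ≤ r := by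
  rcases hr with hr | hr
  · exact (strictMinPow_unique h₀ hr).le
  · rw [hr]
    have := strictMinPow_le_one h₀
    have he' : (1 : ℤ) ≤ (e : ℤ) := by exact_mod_cast he
    linarith

/-- **The band cell is ANTITONE in the member valuation `r`**: a smaller certified `r` only enlarges `j·(e − r) + (1 − r)` (`j ≥ 0`). [folklore] -/
theorem bandCell_of_le {e r r' m c : ℝ} (hc : 0 ≤ c) (hrr' : r' ≤ r) (h : m ≤ c * (e - r) + (1 - r)) : m ≤ c * (e - r') + (1 - r') := by
  nlinarith

/-- **k1 EVALUATION LEMMA (one cell).** At a place with `1 ≤ e` and an UNTIED strict minimum `r₀ = r♯(p, e)`: the `HBand` clause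
«`∃ r, CertVal p e r ∧ LHS ≤ c·(e − r) + (1 − r)`» holds IFF the cell holds at `r₀` — the recipe «r := col 32 r_out_sharp if not (tie)». [folklore] -/
theorem exists_certVal_cell_iff {p e : ℕ} {r₀ : ℤ} (he : 1 ≤ e) (h₀ : StrictMinPow p e r₀) {lhs c : ℝ} (hc : 0 ≤ c) :
    (∃ r : ℤ, CertVal p e r ∧ lhs ≤ c * ((e : ℝ) - r) + (1 - r)) ↔ lhs ≤ c * ((e : ℝ) - r₀) + (1 - r₀) := by
  constructor
  · rintro ⟨r, hr, hcell⟩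
    have hle : (r₀ : ℝ) ≤ r := by exact_mod_cast le_of_certVal_of_strictMin he h₀ hr
    exact bandCell_of_le hc hle hcell
  · intro h; exact ⟨r₀, Or.inl h₀, h⟩

variable {F : Type} [Field F] [NumberField F] (X : PilotData F)

/-- **k1 EVALUATION LEMMA (datum level).** If every bad place of `X` over an odd prime carries an UNTIED strict-minimum certificate `r₀(p, x)` (column
`r_out_sharp` without the `(tie)` flag), then `HBand X` holds IFF at every bad `x ∣ p` and label `j = i+1`: `p` is odd, the fibre is ramification-uniform, and
the INTEGER CELL «`(j² − 1)·m_q(x) ≤ j·(e_x − r₀) + (1 − r₀)`» holds — the two-engine recipe of `plan/rescue/R-H` row 8, made exact (`1 ≤ e_x` from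
`ramIdx_ne_zero`). [claim: Mochizuki2012, status: disputed] for the quoted reading; the equivalence itself is bookkeeping. -/
theorem hBand_iff_cells_of_strictMin
    (r₀ : ∀ pp : Nat.Primes, (thetaIndex X).Fibre (.inr pp) → ℤ)
    (h₀ : ∀ (pp : Nat.Primes) (x : (thetaIndex X).Fibre (.inr pp)),
      haveI : Fact (pp : ℕ).Prime := ⟨pp.2⟩
      placeOf X pp.1 x ∈ X.S → StrictMinPow pp (ramIdx F (placeOf X pp.1 x)) (r₀ pp x)) :
    HBand X ↔
      ∀ (pp : Nat.Primes) (i : Fin X.lstar) (x : (thetaIndex X).Fibre (.inr pp)),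
        haveI : Fact (pp : ℕ).Prime := ⟨pp.2⟩
        placeOf X pp.1 x ∈ X.S →
          2 < (pp : ℕ) ∧
          (∀ x' : (thetaIndex X).Fibre (.inr pp), ramIdx F (placeOf X pp.1 x') = ramIdx F (placeOf X pp.1 x)) ∧
          ((((i : ℕ) : ℝ) + 1) ^ 2 - 1) * X.qPilot (placeOf X pp.1 x)
            ≤ (((i : ℕ) : ℝ) + 1) * ((ramIdx F (placeOf X pp.1 x) : ℝ) - r₀ pp x) + (1 - r₀ pp x) := by
  unfold HBand
  refine forall_congr' fun pp => forall_congr' fun i => forall_congr' fun x => forall_congr' fun hx => ?_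
  haveI : Fact (pp : ℕ).Prime := ⟨pp.2⟩
  have he : 1 ≤ ramIdx F (placeOf X pp.1 x) := Nat.one_le_iff_ne_zero.2 (ramIdx_ne_zero F _)
  have hc : (0 : ℝ) ≤ ((i : ℕ) : ℝ) + 1 := by positivity
  rw [exists_certVal_cell_iff he (h₀ pp x hx) hc]

end Eval

end Summit.ABC.IUTFork.Repair.RHHeightClass

end
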